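import Literature.NumberTheory.LFunctions.WeilExplicitDirichletWeilForm
import Literature.NumberTheory.LFunctions.WeilBochnerExtension
import HarnessLib

/-!
# `weilExplicitRHSWeil_eq_weilFunctionalChar` is false at modulus `q = 0`

Sibling of `WeilExplicitDirichletWeilForm.lean` (which states the dictionary between Weil's printed
right-hand side of (11), `weilExplicitRHSWeil`, and the digamma form `weilFunctionalChar` as the named
fact `weilExplicitRHSWeil_eq_weilFunctionalChar` for ALL moduli `q : ℕ`).

The named fact
`Literature.NumberTheory.LFunctions.weilExplicitRHSWeil_eq_weilFunctionalChar` quantifies over ALL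
`q : ℕ`, including `q = 0` (`ZMod 0 = ℤ`), where Lean's `Real.log (q / (2π)) = Real.log 0 = 0`
while `Real.log q − Real.log π = −log π`.  Comparing the instances `q = 1` and `q = 0` of the
asserted identity for one bump function `g` with `g(0) = 1` (both characters are even, so the
`PF` and digamma terms are literally the same and cancel) leaves `g(0) · log(2π) = 0`: contradiction.
The intended statement needs `[NeZero q]` (then `log(q/2π) = log q − log 2π` for every `q ≥ 1`):
it is the GUARDED restatement `weilExplicitRHSWeil_eq_weilFunctionalChar_of_neZero` appended to
`WeilExplicitDirichletWeilForm.lean` by its author (p321742), which is the name to use.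

## References

* A. Weil, *Sur les "formules explicites" de la théorie des nombres premiers*, Comm. Sém. Math.
  Univ. Lund (1952), 252–265: (3) p. 253 (`A > 0`), (11) pp. 261–262. [Weil1952FormulesExplicites]
-/

noncomputable section

open Complex Real

namespace Literature.NumberTheory.LFunctions

/-- The trivial character modulo `0` is even (`−1` is a unit of `ℤ`). [folklore] -/
private theorem charParity_one_modZero : charParity (1 : DirichletCharacter ℂ 0) = 0 :=
  charParity_of_even (show (1 : DirichletCharacter ℂ 0) (-1) = 1 from
    MulChar.one_apply isUnit_one.neg)

/-- **`weilExplicitRHSWeil_eq_weilFunctionalChar` is false as stated**: the instance `q = 0`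
(`ZMod 0 = ℤ`, trivial character, where Lean's `Real.log (0/2π) = 0` replaces Weil's `log A`,
`A = q/2π`) contradicts the instance `q = 1` for any test function with `g(0) ≠ 0`.  Weil's (11) is
stated for a conductor (`A = N𝔣 · |d|/(2π)ⁿ... > 0`, p. 253 (3)); the dictionary is meant, and
numerically right, for `q ≥ 1` only — use the guarded `weilExplicitRHSWeil_eq_weilFunctionalChar_of_neZero`.
[cite: Weil1952FormulesExplicites, (3) p. 253 and (11) pp. 261–262 (A > 0)] -/
theorem not_weilExplicitRHSWeil_eq_weilFunctionalChar : ¬ weilExplicitRHSWeil_eq_weilFunctionalChar := by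
  intro h
  -- a bump with `g 0 = 1`
  let b : ContDiffBump (0 : ℝ) := ⟨1, 2, one_pos, one_lt_two⟩
  set g : ℝ → ℂ := fun t ↦ ((b t : ℝ) : ℂ) with hg
  have hgt : IsWeilTest g := WeilBochner.isWeilTest_bump b
  have hg0 : g 0 = 1 := by simp [hg, b.one_of_mem_closedBall (Metric.mem_closedBall_self one_pos.le)]
  have h1 := h (1 : DirichletCharacter ℂ 1) hgt
  have h0 := h (1 : DirichletCharacter ℂ 0) hgt
  simp only [weilExplicitRHSWeil, weilFunctionalChar, weilArchTermChar, charParity_modOne,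
    charParity_one_modZero, if_true, Nat.cast_one, Nat.cast_zero, zero_div, Real.log_zero,
    Real.log_one, one_div, zero_sub, hg0, one_mul, Complex.ofReal_zero] at h1 h0
  have hne : (0 : ℕ) ≠ 1 := by norm_num
  simp only [hne, if_false, zero_add, zero_sub] at h0
  -- subtract the two identities: only `g(0) · log (2π)⁻¹` survives
  have key : (Real.log (2 * π)⁻¹ : ℂ) = 0 := by linear_combination h1 - h0
  have : Real.log (2 * π)⁻¹ = 0 := by exact_mod_cast key
  rw [Real.log_inv, neg_eq_zero] at this
  have h2π : 1 < 2 * π := by linarith [Real.pi_gt_three]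
  linarith [Real.log_pos h2π]

end Literature.NumberTheory.LFunctions

end
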